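import Summits.NavierStokesRegularity.NavierStokesRegularity.Theorems.FilamentSkeletonRssCoreLinearInvertibilityArnoldModeSplitToolsC
import Summits.NavierStokesRegularity.NavierStokesRegularity.Theorems.FilamentSkeletonRssCoreLinearInvertibilityOddArnoldToolsB

/-!
# Tools for stub `stub_arnoldModeSplit` (crux `CoreLinearInvertibility`, stmt-NavierStokesRegularity-17973,
# route `FilamentSkeletonRss`, line `Sketch`) — part D: the `k = ±1` circle coefficients of a potential

For the logarithmic potential `ψ_f(x) = ∫ N(x − y) f(y) dy`, `N = (2π)⁻¹ log |·|`, of a continuous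
Gaussian-bounded density `f` on `ℝ²`, and `r > 0`:

  `∫_{-π}^{π} ψ_f(circlePt r θ) cos θ dθ = −(π/2) ∫₀^∞ min(r/s, s/r) a_f(s) s ds`,
  `∫_{-π}^{π} ψ_f(circlePt r θ) sin θ dθ = −(π/2) ∫₀^∞ min(r/s, s/r) b_f(s) s ds`,

`a_f(s) = π⁻¹ ∫ f(circlePt s φ) cos φ dφ`, `b_f(s) = π⁻¹ ∫ f(circlePt s φ) sin φ dφ` — the `k = ±1`
case of Gallay–Šverák's per-mode formula `ψ̂_k(r) = −(2k)⁻¹ ∫₀^∞ min(r/s,s/r)^k f̂_k(s) s ds`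
(arXiv:2110.13739, §3, (Bkdef)): Fubini on `(−π, π] × ℝ²` (part C), the circle moments of the kernel
(part C, off the null circle `|y| = r`), and polar coordinates in `y`.  Also: integrability of
`g ψ_f` for Gaussian-bounded `g`, `f`, and the **symmetry `∫ f ψ_g = ∫ g ψ_f`** (Fubini on `ℝ² × ℝ²`).
Folklore.
-/

set_option linter.dupNamespace false

noncomputable section

namespace Summit.NavierStokesRegularity.NavierStokesRegularity.Theorems

open Set Function Filter MeasureTheory Topology Metric
open Literature.Analysis.FluidPDE Literature.Analysis.Potential
open Summit.AnomalousDissipation.AnomalousDissipation.Theorems.MarginalStabilityChainStretchedVortexRows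
open scoped Real

/-! ### Integrability against the logarithmic kernel and of `g ψ_f` -/

/-- A continuous Gaussian-bounded density is integrable. [folklore] -/
theorem modeSplit_integrable_of_gaussBound {f : EuclideanSpace ℝ (Fin 2) → ℝ} (hf : Continuous f) {B : ℝ}
    (hB : ∀ y, |f y| ≤ B * Real.exp (-(1 / 8) * ‖y‖ ^ 2)) : Integrable f := by
  refine ((integrable_one_add_norm_pow_mul_exp_eighth 0).const_mul B).mono' hf.aestronglyMeasurable
    (Eventually.of_forall fun y => ?_)
  rw [Real.norm_eq_abs, pow_zero, one_mul]; exact hB y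

/-- `y ↦ N(x − y) f(y)` is integrable for a continuous Gaussian-bounded `f`. [folklore] -/
theorem modeSplit_integrable_logKernel_mul {f : EuclideanSpace ℝ (Fin 2) → ℝ} (hf : Continuous f) {B : ℝ}
    (hB : ∀ y, |f y| ≤ B * Real.exp (-(1 / 8) * ‖y‖ ^ 2)) (x : EuclideanSpace ℝ (Fin 2)) :
    Integrable fun y => (2 * Real.pi)⁻¹ * Real.log ‖x - y‖ * f y := by
  obtain ⟨K, -, hK⟩ := modeSplit_integral_abs_log_mul_le hf hB
  refine ((hK x).1.const_mul (2 * π)⁻¹).mono'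
    (((measurable_const.mul (measurable_const.sub measurable_id).norm.log).mul
      hf.measurable).aestronglyMeasurable) (Eventually.of_forall fun y => ?_)
  rw [Real.norm_eq_abs, abs_mul, abs_mul, abs_of_pos (by positivity : (0 : ℝ) < (2 * π)⁻¹), mul_assoc]

/-- **`g ψ_f ∈ L¹`** for continuous Gaussian-bounded `f`, `g` (`|ψ_f(x)| ≤ C(1 + log(1+|x|)) ≤ C(1+|x|)`).
[folklore] -/
theorem modeSplit_integrable_mul_logPotential {f g : EuclideanSpace ℝ (Fin 2) → ℝ} (hf : Continuous f)
    (hg : Continuous g) {Bf Bg : ℝ} (hBf : ∀ y, |f y| ≤ Bf * Real.exp (-(1 / 8) * ‖y‖ ^ 2))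
    (hBg : ∀ x, |g x| ≤ Bg * Real.exp (-(1 / 8) * ‖x‖ ^ 2)) :
    Integrable fun x => g x * ∫ y, (2 * Real.pi)⁻¹ * Real.log ‖x - y‖ * f y := by
  obtain ⟨C, hC0, hC⟩ := abs_logPotential_le hBf
  have hBg0 : 0 ≤ Bg := (abs_nonneg _).trans ((hBg 0).trans (le_of_eq (by simp)))
  refine ((integrable_one_add_norm_pow_mul_exp_eighth 1).const_mul (Bg * C)).mono'
    (hg.aestronglyMeasurable.mul (arnold_aestronglyMeasurable_logPotential hf.aestronglyMeasurable))
    (Eventually.of_forall fun x => ?_)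
  rw [Real.norm_eq_abs, abs_mul, pow_one]
  have hlog : Real.log (1 + ‖x‖) ≤ ‖x‖ := by
    have := Real.log_le_sub_one_of_pos (by positivity : (0 : ℝ) < 1 + ‖x‖); linarith
  calc |g x| * |∫ y, (2 * Real.pi)⁻¹ * Real.log ‖x - y‖ * f y|
      ≤ (Bg * Real.exp (-(1 / 8) * ‖x‖ ^ 2)) * (C * (1 + Real.log (1 + ‖x‖))) :=
        mul_le_mul (hBg x) (hC x) (abs_nonneg _) (by positivity)
    _ ≤ (Bg * Real.exp (-(1 / 8) * ‖x‖ ^ 2)) * (C * (1 + ‖x‖)) := by gcongr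
    _ = Bg * C * ((1 + ‖x‖) * Real.exp (-(1 / 8) * ‖x‖ ^ 2)) := by ring

/-! ### The kernel moments against a density, in polar coordinates -/

/-- `∫ f(y) t(r,|y|) y₀/|y| dy = ∫₀^∞ s t(r,s) ∫ f(circlePt s φ) cos φ dφ ds` (polar coordinates). [folklore] -/
theorem modeSplit_integral_mul_kernelMoment_cos {f : EuclideanSpace ℝ (Fin 2) → ℝ} (hf : Continuous f)
    (hfi : Integrable f) {r : ℝ} (hr : 0 < r) :
    ∫ y : EuclideanSpace ℝ (Fin 2), f y * ((min r ‖y‖ / max r ‖y‖) * (y 0 / ‖y‖)) =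
      ∫ s in Ioi (0 : ℝ), s * (min r s / max r s) * ∫ φ in (-π)..π, f (circlePt s φ) * Real.cos φ := by
  have hπ : -π ≤ π := by linarith [Real.pi_pos]
  have hM : ∀ y : EuclideanSpace ℝ (Fin 2), max r ‖y‖ ≠ 0 := fun y => (lt_max_of_lt_left hr).ne'
  have hint : Integrable fun y : EuclideanSpace ℝ (Fin 2) => f y * ((min r ‖y‖ / max r ‖y‖) * (y 0 / ‖y‖)) := by
    refine hfi.norm.mono' (hf.aestronglyMeasurable.mul
      ((((continuous_const.min continuous_norm).div (continuous_const.max continuous_norm)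
        hM).measurable.mul ((PiLp.continuous_apply 2 _ 0).measurable.div
          continuous_norm.measurable)).aestronglyMeasurable)) (Eventually.of_forall fun y => ?_)
    rw [norm_mul, norm_mul]
    have ht : ‖min r ‖y‖ / max r ‖y‖‖ ≤ 1 := by
      rw [Real.norm_of_nonneg (div_nonneg (le_min hr.le (norm_nonneg y)) (le_max_of_le_right (norm_nonneg y)))]
      exact div_le_one_of_le₀ min_le_max (le_max_of_le_right (norm_nonneg y))
    have hq : ‖y 0 / ‖y‖‖ ≤ 1 := by
      rw [norm_div, norm_norm]
      exact div_le_one_of_le₀ (PiLp.norm_apply_le y 0) (norm_nonneg _)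
    calc ‖f y‖ * (‖min r ‖y‖ / max r ‖y‖‖ * ‖y 0 / ‖y‖‖) ≤ ‖f y‖ * (1 * 1) := by gcongr
      _ = ‖f y‖ := by ring
  rw [integral_eq_integral_circlePt hint]
  refine setIntegral_congr_fun measurableSet_Ioi fun s hs => ?_
  have hs : 0 < s := hs
  have h1 : ∀ φ : ℝ, s • (f (circlePt s φ) * ((min r ‖circlePt s φ‖ / max r ‖circlePt s φ‖) *
      (circlePt s φ 0 / ‖circlePt s φ‖))) =
      s * (min r s / max r s) * (f (circlePt s φ) * Real.cos φ) := by
    intro φ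
    rw [norm_circlePt, abs_of_pos hs, circlePt_apply_zero, smul_eq_mul]
    field_simp
  simp_rw [h1]
  rw [integral_const_mul, ← intervalIntegral.integral_of_le hπ]

/-- `∫ f(y) t(r,|y|) y₁/|y| dy = ∫₀^∞ s t(r,s) ∫ f(circlePt s φ) sin φ dφ ds`. [folklore] -/
theorem modeSplit_integral_mul_kernelMoment_sin {f : EuclideanSpace ℝ (Fin 2) → ℝ} (hf : Continuous f)
    (hfi : Integrable f) {r : ℝ} (hr : 0 < r) :
    ∫ y : EuclideanSpace ℝ (Fin 2), f y * ((min r ‖y‖ / max r ‖y‖) * (y 1 / ‖y‖)) =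
      ∫ s in Ioi (0 : ℝ), s * (min r s / max r s) * ∫ φ in (-π)..π, f (circlePt s φ) * Real.sin φ := by
  have hπ : -π ≤ π := by linarith [Real.pi_pos]
  have hM : ∀ y : EuclideanSpace ℝ (Fin 2), max r ‖y‖ ≠ 0 := fun y => (lt_max_of_lt_left hr).ne'
  have hint : Integrable fun y : EuclideanSpace ℝ (Fin 2) => f y * ((min r ‖y‖ / max r ‖y‖) * (y 1 / ‖y‖)) := by
    refine hfi.norm.mono' (hf.aestronglyMeasurable.mul
      ((((continuous_const.min continuous_norm).div (continuous_const.max continuous_norm)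
        hM).measurable.mul ((PiLp.continuous_apply 2 _ 1).measurable.div
          continuous_norm.measurable)).aestronglyMeasurable)) (Eventually.of_forall fun y => ?_)
    rw [norm_mul, norm_mul]
    have ht : ‖min r ‖y‖ / max r ‖y‖‖ ≤ 1 := by
      rw [Real.norm_of_nonneg (div_nonneg (le_min hr.le (norm_nonneg y)) (le_max_of_le_right (norm_nonneg y)))]
      exact div_le_one_of_le₀ min_le_max (le_max_of_le_right (norm_nonneg y))
    have hq : ‖y 1 / ‖y‖‖ ≤ 1 := by
      rw [norm_div, norm_norm]
      exact div_le_one_of_le₀ (PiLp.norm_apply_le y 1) (norm_nonneg _)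
    calc ‖f y‖ * (‖min r ‖y‖ / max r ‖y‖‖ * ‖y 1 / ‖y‖‖) ≤ ‖f y‖ * (1 * 1) := by gcongr
      _ = ‖f y‖ := by ring
  rw [integral_eq_integral_circlePt hint]
  refine setIntegral_congr_fun measurableSet_Ioi fun s hs => ?_
  have hs : 0 < s := hs
  have h1 : ∀ φ : ℝ, s • (f (circlePt s φ) * ((min r ‖circlePt s φ‖ / max r ‖circlePt s φ‖) *
      (circlePt s φ 1 / ‖circlePt s φ‖))) =
      s * (min r s / max r s) * (f (circlePt s φ) * Real.sin φ) := by
    intro φ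
    rw [norm_circlePt, abs_of_pos hs, circlePt_apply_one, smul_eq_mul]
    field_simp
  simp_rw [h1]
  rw [integral_const_mul, ← intervalIntegral.integral_of_le hπ]

/-! ### The `k = ±1` circle coefficients of `ψ_f` -/

/-- Fubini step: `∫_{-π}^{π} ψ_f(circlePt r θ) w(θ) dθ = ∫ f(y) (2π)⁻¹ ∫_{-π}^{π} log|circlePt r θ − y| w(θ) dθ dy`.
[folklore] -/
theorem modeSplit_circleInt_logPotential_swap {f : EuclideanSpace ℝ (Fin 2) → ℝ} (hf : Continuous f) {B : ℝ}
    (hB : ∀ y, |f y| ≤ B * Real.exp (-(1 / 8) * ‖y‖ ^ 2)) (r : ℝ) {w : ℝ → ℝ} (hw : Continuous w)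
    (hw1 : ∀ θ, |w θ| ≤ 1) :
    ∫ θ in (-π)..π, (∫ y, (2 * Real.pi)⁻¹ * Real.log ‖circlePt r θ - y‖ * f y) * w θ =
      ∫ y, f y * ((2 * π)⁻¹ * ∫ θ in (-π)..π, Real.log ‖circlePt r θ - y‖ * w θ) := by
  have hπ : -π ≤ π := by linarith [Real.pi_pos]
  have hI := modeSplit_integrable_circle_logKernel hf hB r hw hw1
  have hswap := intervalIntegral_integral_swap (μ := volume) (a := -π) (b := π)
    (f := fun (θ : ℝ) (y : EuclideanSpace ℝ (Fin 2)) => w θ * ((2 * Real.pi)⁻¹ * Real.log ‖circlePt r θ - y‖ * f y))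
    (by rwa [uIoc_of_le hπ])
  calc ∫ θ in (-π)..π, (∫ y, (2 * Real.pi)⁻¹ * Real.log ‖circlePt r θ - y‖ * f y) * w θ
      = ∫ θ in (-π)..π, ∫ y, w θ * ((2 * Real.pi)⁻¹ * Real.log ‖circlePt r θ - y‖ * f y) := by
        refine intervalIntegral.integral_congr fun θ _ => ?_
        rw [integral_const_mul, mul_comm]
    _ = ∫ y, ∫ θ in (-π)..π, w θ * ((2 * Real.pi)⁻¹ * Real.log ‖circlePt r θ - y‖ * f y) := hswap
    _ = ∫ y, f y * ((2 * π)⁻¹ * ∫ θ in (-π)..π, Real.log ‖circlePt r θ - y‖ * w θ) := by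
        refine integral_congr_ae (Eventually.of_forall fun y => ?_)
        simp only
        rw [← intervalIntegral.integral_const_mul, ← intervalIntegral.integral_const_mul]
        exact intervalIntegral.integral_congr fun θ _ => by ring

/-- **The cosine circle coefficient of `ψ_f`**: for `r > 0`,
`∫_{-π}^{π} ψ_f(circlePt r θ) cos θ dθ = −(π/2) ∫₀^∞ min(r/s, s/r) a_f(s) s ds`. [folklore] -/
theorem modeSplit_circle_logPotential_cos {f : EuclideanSpace ℝ (Fin 2) → ℝ} (hf : Continuous f) {B : ℝ}
    (hB : ∀ y, |f y| ≤ B * Real.exp (-(1 / 8) * ‖y‖ ^ 2)) {r : ℝ} (hr : 0 < r) {af : ℝ → ℝ}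
    (haf : ∀ s, af s = (1 / Real.pi) * ∫ φ in (-Real.pi)..Real.pi, f (circlePt s φ) * Real.cos φ) :
    ∫ θ in (-π)..π, (∫ y, (2 * Real.pi)⁻¹ * Real.log ‖circlePt r θ - y‖ * f y) * Real.cos θ =
      -(π / 2) * ∫ s in Ioi (0 : ℝ), min (r / s) (s / r) * af s * s := by
  have hfi : Integrable f := modeSplit_integrable_of_gaussBound hf hB
  rw [modeSplit_circleInt_logPotential_swap hf hB r Real.continuous_cos Real.abs_cos_le_one]
  have hae : ∫ y, f y * ((2 * π)⁻¹ * ∫ θ in (-π)..π, Real.log ‖circlePt r θ - y‖ * Real.cos θ) =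
      ∫ y, -(1 / 2) * (f y * ((min r ‖y‖ / max r ‖y‖) * (y 0 / ‖y‖))) := by
    refine integral_congr_ae ?_
    have hae : ∀ᵐ y : EuclideanSpace ℝ (Fin 2) ∂volume, y ∉ sphere (0 : EuclideanSpace ℝ (Fin 2)) r :=
      measure_eq_zero_iff_ae_notMem.1 (Measure.addHaar_sphere volume (0 : EuclideanSpace ℝ (Fin 2)) r)
    filter_upwards [hae] with y hy
    rw [mem_sphere_zero_iff_norm] at hy
    rw [modeSplit_integral_log_circle_cos hr hy]
    field_simp
  rw [hae, integral_const_mul, modeSplit_integral_mul_kernelMoment_cos hf hfi hr,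
    show -(π / 2) * (∫ s in Ioi (0 : ℝ), min (r / s) (s / r) * af s * s) =
      -(1 / 2) * (π * ∫ s in Ioi (0 : ℝ), min (r / s) (s / r) * af s * s) by ring,
    ← integral_const_mul π]
  congr 1
  refine setIntegral_congr_fun measurableSet_Ioi fun s hs => ?_
  rw [modeSplit_circleInt_eq_pi_mul haf s, modeSplit_min_div_max hr hs]
  ring

/-- **The sine circle coefficient of `ψ_f`**: for `r > 0`,
`∫_{-π}^{π} ψ_f(circlePt r θ) sin θ dθ = −(π/2) ∫₀^∞ min(r/s, s/r) b_f(s) s ds`. [folklore] -/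
theorem modeSplit_circle_logPotential_sin {f : EuclideanSpace ℝ (Fin 2) → ℝ} (hf : Continuous f) {B : ℝ}
    (hB : ∀ y, |f y| ≤ B * Real.exp (-(1 / 8) * ‖y‖ ^ 2)) {r : ℝ} (hr : 0 < r) {bf : ℝ → ℝ}
    (hbf : ∀ s, bf s = (1 / Real.pi) * ∫ φ in (-Real.pi)..Real.pi, f (circlePt s φ) * Real.sin φ) :
    ∫ θ in (-π)..π, (∫ y, (2 * Real.pi)⁻¹ * Real.log ‖circlePt r θ - y‖ * f y) * Real.sin θ =
      -(π / 2) * ∫ s in Ioi (0 : ℝ), min (r / s) (s / r) * bf s * s := by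
  have hfi : Integrable f := modeSplit_integrable_of_gaussBound hf hB
  rw [modeSplit_circleInt_logPotential_swap hf hB r Real.continuous_sin Real.abs_sin_le_one]
  have hae : ∫ y, f y * ((2 * π)⁻¹ * ∫ θ in (-π)..π, Real.log ‖circlePt r θ - y‖ * Real.sin θ) =
      ∫ y, -(1 / 2) * (f y * ((min r ‖y‖ / max r ‖y‖) * (y 1 / ‖y‖))) := by
    refine integral_congr_ae ?_
    have hae : ∀ᵐ y : EuclideanSpace ℝ (Fin 2) ∂volume, y ∉ sphere (0 : EuclideanSpace ℝ (Fin 2)) r :=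
      measure_eq_zero_iff_ae_notMem.1 (Measure.addHaar_sphere volume (0 : EuclideanSpace ℝ (Fin 2)) r)
    filter_upwards [hae] with y hy
    rw [mem_sphere_zero_iff_norm] at hy
    rw [modeSplit_integral_log_circle_sin hr hy]
    field_simp
  rw [hae, integral_const_mul, modeSplit_integral_mul_kernelMoment_sin hf hfi hr,
    show -(π / 2) * (∫ s in Ioi (0 : ℝ), min (r / s) (s / r) * bf s * s) =
      -(1 / 2) * (π * ∫ s in Ioi (0 : ℝ), min (r / s) (s / r) * bf s * s) by ring,
    ← integral_const_mul π]
  congr 1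
  refine setIntegral_congr_fun measurableSet_Ioi fun s hs => ?_
  rw [modeSplit_circleInt_eq_pi_mul hbf s, modeSplit_min_div_max hr hs]
  ring

/-! ### Symmetry of the energy form -/

/-- **`∫ g ψ_f = ∫ f ψ_g`** for continuous Gaussian-bounded `f`, `g` (Fubini on `ℝ² × ℝ²`: the slices
`x ↦ ∫ |g(x) N(x − y) f(y)| dy ≤ (2π)⁻¹ |g(x)| K(1 + |x|)` are integrable). [folklore] -/
theorem modeSplit_integral_mul_logPotential_comm {f g : EuclideanSpace ℝ (Fin 2) → ℝ} (hf : Continuous f)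
    (hg : Continuous g) {Bf Bg : ℝ} (hBf : ∀ y, |f y| ≤ Bf * Real.exp (-(1 / 8) * ‖y‖ ^ 2))
    (hBg : ∀ x, |g x| ≤ Bg * Real.exp (-(1 / 8) * ‖x‖ ^ 2)) :
    ∫ x, g x * ∫ y, (2 * Real.pi)⁻¹ * Real.log ‖x - y‖ * f y =
      ∫ y, f y * ∫ x, (2 * Real.pi)⁻¹ * Real.log ‖y - x‖ * g x := by
  obtain ⟨K, hK0, hK⟩ := modeSplit_integral_abs_log_mul_le hf hBf
  have hBg0 : 0 ≤ Bg := (abs_nonneg _).trans ((hBg 0).trans (le_of_eq (by simp)))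
  set H : EuclideanSpace ℝ (Fin 2) → EuclideanSpace ℝ (Fin 2) → ℝ :=
    fun x y => g x * ((2 * Real.pi)⁻¹ * Real.log ‖x - y‖ * f y) with hH
  have hmeas : Measurable (uncurry H) :=
    (hg.measurable.comp measurable_fst).mul ((measurable_const.mul
      (measurable_fst.sub measurable_snd).norm.log).mul (hf.measurable.comp measurable_snd))
  have hnorm : ∀ x y, ‖H x y‖ = (2 * π)⁻¹ * |g x| * (|Real.log ‖x - y‖| * |f y|) := by
    intro x y
    simp only [hH, Real.norm_eq_abs, abs_mul, abs_of_pos (by positivity : (0 : ℝ) < (2 * π)⁻¹)]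
    ring
  have hint : Integrable (uncurry H) (volume.prod volume) := by
    rw [integrable_prod_iff hmeas.aestronglyMeasurable]
    constructor
    · refine Eventually.of_forall fun x => ?_
      exact ((hK x).1.const_mul ((2 * π)⁻¹ * |g x|)).mono'
        (hmeas.comp measurable_prodMk_left).aestronglyMeasurable
        (Eventually.of_forall fun y => (hnorm x y).le)
    · refine (((integrable_one_add_norm_pow_mul_exp_eighth 1).const_mul ((2 * π)⁻¹ * Bg * K))).mono'
        hmeas.aestronglyMeasurable.norm.integral_prod_right' (Eventually.of_forall fun x => ?_)
      rw [Real.norm_of_nonneg (integral_nonneg fun y => norm_nonneg _)]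
      calc ∫ y, ‖uncurry H (x, y)‖ = ∫ y, (2 * π)⁻¹ * |g x| * (|Real.log ‖x - y‖| * |f y|) :=
            integral_congr_ae (Eventually.of_forall fun y => hnorm x y)
        _ = (2 * π)⁻¹ * |g x| * ∫ y, |Real.log ‖x - y‖| * |f y| := integral_const_mul _ _
        _ ≤ (2 * π)⁻¹ * (Bg * Real.exp (-(1 / 8) * ‖x‖ ^ 2)) * (K * (1 + ‖x‖)) :=
            mul_le_mul (mul_le_mul_of_nonneg_left (hBg x) (by positivity)) (hK x).2
              (integral_nonneg fun y => by positivity) (by positivity)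
        _ = (2 * π)⁻¹ * Bg * K * ((1 + ‖x‖) ^ 1 * Real.exp (-(1 / 8) * ‖x‖ ^ 2)) := by ring
  have hswap := integral_integral_swap hint
  calc ∫ x, g x * ∫ y, (2 * Real.pi)⁻¹ * Real.log ‖x - y‖ * f y = ∫ x, ∫ y, H x y :=
        integral_congr_ae (Eventually.of_forall fun x => (integral_const_mul _ _).symm)
    _ = ∫ y, ∫ x, H x y := hswap
    _ = ∫ y, f y * ∫ x, (2 * Real.pi)⁻¹ * Real.log ‖y - x‖ * g x := by
        refine integral_congr_ae (Eventually.of_forall fun y => ?_)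
        simp only [hH]
        rw [← integral_const_mul]
        exact integral_congr_ae (Eventually.of_forall fun x => by dsimp only; rw [norm_sub_rev]; ring)

/-! ### The registered tools stub -/

/-- **Registered tools stub `stub_arnoldModeSplitToolsD`** (helpers for `stub_arnoldModeSplit`, line `Sketch`
of crux `CoreLinearInvertibility`, stmt-NavierStokesRegularity-17973): the `k = ±1` circle coefficients of the
potential `ψ_f = N ∗ f` of a continuous Gaussian-bounded density
(`∫ ψ_f(circlePt r θ) cos θ dθ = −(π/2) ∫₀^∞ min(r/s,s/r) a_f(s) s ds`, same with `sin`, `b_f`), the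
integrability of `g ψ_f`, and the symmetry `∫ g ψ_f = ∫ f ψ_g`. [folklore] -/
theorem stub_arnoldModeSplitToolsD :
    ∀ f : EuclideanSpace ℝ (Fin 2) → ℝ, Continuous f → ∀ B : ℝ,
    (∀ y, |f y| ≤ B * Real.exp (-(1 / 8) * ‖y‖ ^ 2)) →
    (∀ (af bf : ℝ → ℝ),
      (∀ s, af s = (1 / Real.pi) * ∫ φ in (-Real.pi)..Real.pi, f (circlePt s φ) * Real.cos φ) →
      (∀ s, bf s = (1 / Real.pi) * ∫ φ in (-Real.pi)..Real.pi, f (circlePt s φ) * Real.sin φ) →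
      ∀ r : ℝ, 0 < r →
        ∫ θ in (-Real.pi)..Real.pi, (∫ y, (2 * Real.pi)⁻¹ * Real.log ‖circlePt r θ - y‖ * f y) * Real.cos θ =
          -(Real.pi / 2) * ∫ s in Set.Ioi (0 : ℝ), min (r / s) (s / r) * af s * s ∧
        ∫ θ in (-Real.pi)..Real.pi, (∫ y, (2 * Real.pi)⁻¹ * Real.log ‖circlePt r θ - y‖ * f y) * Real.sin θ =
          -(Real.pi / 2) * ∫ s in Set.Ioi (0 : ℝ), min (r / s) (s / r) * bf s * s) ∧
    ∀ g : EuclideanSpace ℝ (Fin 2) → ℝ, Continuous g → ∀ B' : ℝ,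
      (∀ x, |g x| ≤ B' * Real.exp (-(1 / 8) * ‖x‖ ^ 2)) →
      Integrable (fun x => g x * ∫ y, (2 * Real.pi)⁻¹ * Real.log ‖x - y‖ * f y) ∧
      ∫ x, g x * ∫ y, (2 * Real.pi)⁻¹ * Real.log ‖x - y‖ * f y =
        ∫ y, f y * ∫ x, (2 * Real.pi)⁻¹ * Real.log ‖y - x‖ * g x :=
  fun _ hf _ hB =>
    ⟨fun _ _ haf hbf _ hr =>
        ⟨modeSplit_circle_logPotential_cos hf hB hr haf, modeSplit_circle_logPotential_sin hf hB hr hbf⟩,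
      fun _ hg _ hBg =>
        ⟨modeSplit_integrable_mul_logPotential hf hg hB hBg,
          modeSplit_integral_mul_logPotential_comm hf hg hB hBg⟩⟩

end Summit.NavierStokesRegularity.NavierStokesRegularity.Theorems
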